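import Summits.CriticalPhenomena.PercolationContinuityZ3.Theorems.PercNearOneGluingNoHeavyConstsMDLXJointVertexFn
import Summits.CriticalPhenomena.PercolationContinuityZ3.Theorems.PercNearOneGluingNoHeavyConstsMDLXJointUnconditioning
import Summits.CriticalPhenomena.PercolationContinuityZ3.Theorems.PercNearOneGluingNoHeavyConstsMDLXJointMarkerLattice
import HarnessLib

/-!
# The INTERVAL LAW for the avoidance-enlargement gap of one source (typed conjecture, interior reduction, proved corners)
# (PAPER-2 track (ii): constants of the CSH family; seat `prim-consts-2`, gen 12)

builds on p205010 (kernel theorem, internal audit signed; external expert review pending).  Support file (`--supports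
stmt-CriticalPhenomena-4575`); memo `run/shared/lean/prim/consts/FROM-prim-consts-2-g12-EDGE-GIBBS.md` §0(3), §3, sheet `FOR-PAPER2-interval-law-g12.md`.
One `Prop` definition (an OPEN conjecture, tagged `@[conjecture]`); theorems; no sorries; standard axioms.

Setting: finite weighted graph (`Fin n`, `μ = prodBernoulli w`), a source `s`, markers `y, z`, `W = {y↔z}`; for a vertex set `A`, `R_A := {s ↮ A}` and
`K_A := μ(R_A)` (one row of the avoidance kernel); for a vertex set `C`, the three-way separation `T_C := {y ↮ {s}∪C} ∩ {s ↮ C}`.  For `A ⊆ B` the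
AVOIDANCE-ENLARGEMENT GAP at `t` is `F_{A,B}(t) := K_A·K_{B∪{t}} − K_B·K_{A∪{t}}` (`= K_AK_B·[P(s↮t | s↮B) − P(s↮t | s↮A)] ≥ 0`, van den Berg–Häggström–Kahn
Thm 1.1).

* `Consts.AvoidanceIntervalLaw` — **CONJECTURE (gen 12)**: for all `A ⊆ C ⊆ B`,  `μ(T_C ∩ W)·F_{A,B}(y) ≤ μ(T_C)·F_{A,B}(z)`  ("the gain at `z` is at least
  `p′(C) = P(y↔z | T_C)` times the gain at `y`, for every conditioning set `C` in the interval `[A, B]`").  Dictionary: `C = A = X`, `B = X ∪ B′` is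
  `Consts.MDLXJoint` at the hitting functional `1{C_s ∩ B′ ≠ ∅}` (`B′ = {a}`: `Consts.mdlxJoint_at_connIndicator_iff_minor`); `C = B` is the "top" edge.
  EVIDENCE (exact recheck of every float candidate; kit j163879/j163880/j163881, n = 6, 7, 8, corner/dense/generic palettes): 0 violations in 1.9·10⁸
  triples with `A ⊆ C ⊆ B`; by contrast 12 % violations for `C ⊊ A`, 4–5 % for `C` incomparable, 0.2 % for `C ⊋ B` — the interval is sharp.
* `Consts.avoidGap_interior_identity` — `K_C·F_{A,B}(t) = K_B·F_{A,C}(t) + K_A·F_{C,B}(t)` (ring identity), whence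
  `Consts.intervalLaw_interior_of_edges` — the law at `(A,B;C)` follows from the two EDGE instances `(A,C;C)` (top) and `(C,B;C)` (bottom): the conjecture
  is equivalent to its two edge families `C = A` and `C = B`.
* Proved corners (KERNEL, re-exported in the conjecture's shape): `Consts.intervalLaw_top_empty` — `A = ∅`, `C = B` (`Consts.uncondition_marker_le`);
  `Consts.intervalLaw_bot_marker_y` / `_z` — `C = A`, `B = A ∪ {y}` resp. `A ∪ {z}` (the owner-side marker theorems via
  `Consts.mdlxJoint_at_connIndicator_iff_minor`).
Not addressed here: the source-enlargement analogue SEM (memo §0(3)); the three-copy profile form (AEM-BERN, memo §0(6)).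
[cite: VandenbergHaggstromKahn2005, Thm. 1.1 (p. 3), Thm. 1.3 (p. 6), Thm. 2.1 (p. 9), §2.1 (pp. 9–13)] [status: open]
-/

noncomputable section

namespace Summit.CriticalPhenomena.PercolationContinuityZ3.Theorems

open MeasureTheory Set Literature.Probability.LatticeModels Literature.Probability.Percolation
open scoped Classical

namespace Consts

variable {V : Type*} [Fintype V]

/-- **CONJECTURE — the interval law for the avoidance-enlargement gap (gen 12).**  For every finite weighted graph, source `s`, markers `y, z`
and vertex sets `A ⊆ C ⊆ B`:  `μ(T_C ∩ W)·[K_A K_{B∪{y}} − K_B K_{A∪{y}}] ≤ μ(T_C)·[K_A K_{B∪{z}} − K_B K_{A∪{z}}]`, where `K_A = μ{s ↮ A}`,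
`T_C = {y ↮ {s}∪C} ∩ {s ↮ C}`, `W = {y ↔ z}`.  OPEN; census 0 / 1.9·10⁸ inside the interval (n ≤ 8), violated outside it.  Its `C = A` edge at
`B = A ∪ {a}` is `Consts.MDLXJoint` at the vertex functional `1{s↔a}`; its `A = ∅, C = B` corner is `Consts.uncondition_marker_le`.
builds on p205010 (kernel theorem, internal audit signed; external expert review pending).
[cite: VandenbergHaggstromKahn2005, Thm. 1.1 (p. 3), §2.1 (pp. 9–13)] [status: open] -/
@[conjecture] def AvoidanceIntervalLaw : Prop :=
  ∀ (n : ℕ) (w : Sym2 (Fin n) → unitInterval) (s y z : Fin n) (A B C : Set (Fin n)), A ⊆ C → C ⊆ B →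
    (prodBernoulli w).real ({ω : BondConfig (Fin n) | ∀ x ∈ insert s C, ¬ (openGraph ω).Reachable y x} ∩
        {ω | ∀ x ∈ C, ¬ (openGraph ω).Reachable s x} ∩ openConn y z) *
      ((prodBernoulli w).real {ω : BondConfig (Fin n) | ∀ x ∈ A, ¬ (openGraph ω).Reachable s x} *
          (prodBernoulli w).real {ω : BondConfig (Fin n) | ∀ x ∈ insert y B, ¬ (openGraph ω).Reachable s x} -
        (prodBernoulli w).real {ω : BondConfig (Fin n) | ∀ x ∈ B, ¬ (openGraph ω).Reachable s x} *
          (prodBernoulli w).real {ω : BondConfig (Fin n) | ∀ x ∈ insert y A, ¬ (openGraph ω).Reachable s x}) ≤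
    (prodBernoulli w).real ({ω : BondConfig (Fin n) | ∀ x ∈ insert s C, ¬ (openGraph ω).Reachable y x} ∩
        {ω | ∀ x ∈ C, ¬ (openGraph ω).Reachable s x}) *
      ((prodBernoulli w).real {ω : BondConfig (Fin n) | ∀ x ∈ A, ¬ (openGraph ω).Reachable s x} *
          (prodBernoulli w).real {ω : BondConfig (Fin n) | ∀ x ∈ insert z B, ¬ (openGraph ω).Reachable s x} -
        (prodBernoulli w).real {ω : BondConfig (Fin n) | ∀ x ∈ B, ¬ (openGraph ω).Reachable s x} *
          (prodBernoulli w).real {ω : BondConfig (Fin n) | ∀ x ∈ insert z A, ¬ (openGraph ω).Reachable s x})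

/-- **Interior identity of the avoidance gaps**: `K_C·F_{A,B}(t) = K_B·F_{A,C}(t) + K_A·F_{C,B}(t)` for `F_{P,Q}(t) = K_P K_{Q∪t} − K_Q K_{P∪t}`
(a ring identity in the six numbers `K_A, K_B, K_C, K_{A∪t}, K_{B∪t}, K_{C∪t}`; no inclusion hypothesis is needed). [folklore] -/
theorem avoidGap_interior_identity (kA kB kC kAt kBt kCt : ℝ) :
    kC * (kA * kBt - kB * kAt) = kB * (kA * kCt - kC * kAt) + kA * (kC * kBt - kB * kCt) := by
  ring

omit [Fintype V] in
/-- **The interval law at `(A,B;C)` follows from its two edge instances `(A,C;C)` and `(C,B;C)`** (any `V`, any weights; the only structural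
input is `T_C ⊆ R_C`, so that `K_C = 0` forces both sides to vanish): from
`μ(T_C∩W)·F_{A,C}(y) ≤ μ(T_C)·F_{A,C}(z)` and `μ(T_C∩W)·F_{C,B}(y) ≤ μ(T_C)·F_{C,B}(z)` conclude `μ(T_C∩W)·F_{A,B}(y) ≤ μ(T_C)·F_{A,B}(z)`.
[cite: VandenbergHaggstromKahn2005, Thm. 1.1 (p. 3) — bookkeeping, derived here] -/
theorem intervalLaw_interior_of_edges (w : Sym2 V → unitInterval) (s y z : V) (A B C : Set V)
    (h₁ : (prodBernoulli w).real ({ω : BondConfig V | ∀ x ∈ insert s C, ¬ (openGraph ω).Reachable y x} ∩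
          {ω | ∀ x ∈ C, ¬ (openGraph ω).Reachable s x} ∩ openConn y z) *
        ((prodBernoulli w).real {ω : BondConfig V | ∀ x ∈ A, ¬ (openGraph ω).Reachable s x} *
            (prodBernoulli w).real {ω : BondConfig V | ∀ x ∈ insert y C, ¬ (openGraph ω).Reachable s x} -
          (prodBernoulli w).real {ω : BondConfig V | ∀ x ∈ C, ¬ (openGraph ω).Reachable s x} *
            (prodBernoulli w).real {ω : BondConfig V | ∀ x ∈ insert y A, ¬ (openGraph ω).Reachable s x}) ≤
      (prodBernoulli w).real ({ω : BondConfig V | ∀ x ∈ insert s C, ¬ (openGraph ω).Reachable y x} ∩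
          {ω | ∀ x ∈ C, ¬ (openGraph ω).Reachable s x}) *
        ((prodBernoulli w).real {ω : BondConfig V | ∀ x ∈ A, ¬ (openGraph ω).Reachable s x} *
            (prodBernoulli w).real {ω : BondConfig V | ∀ x ∈ insert z C, ¬ (openGraph ω).Reachable s x} -
          (prodBernoulli w).real {ω : BondConfig V | ∀ x ∈ C, ¬ (openGraph ω).Reachable s x} *
            (prodBernoulli w).real {ω : BondConfig V | ∀ x ∈ insert z A, ¬ (openGraph ω).Reachable s x}))
    (h₂ : (prodBernoulli w).real ({ω : BondConfig V | ∀ x ∈ insert s C, ¬ (openGraph ω).Reachable y x} ∩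
          {ω | ∀ x ∈ C, ¬ (openGraph ω).Reachable s x} ∩ openConn y z) *
        ((prodBernoulli w).real {ω : BondConfig V | ∀ x ∈ C, ¬ (openGraph ω).Reachable s x} *
            (prodBernoulli w).real {ω : BondConfig V | ∀ x ∈ insert y B, ¬ (openGraph ω).Reachable s x} -
          (prodBernoulli w).real {ω : BondConfig V | ∀ x ∈ B, ¬ (openGraph ω).Reachable s x} *
            (prodBernoulli w).real {ω : BondConfig V | ∀ x ∈ insert y C, ¬ (openGraph ω).Reachable s x}) ≤
      (prodBernoulli w).real ({ω : BondConfig V | ∀ x ∈ insert s C, ¬ (openGraph ω).Reachable y x} ∩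
          {ω | ∀ x ∈ C, ¬ (openGraph ω).Reachable s x}) *
        ((prodBernoulli w).real {ω : BondConfig V | ∀ x ∈ C, ¬ (openGraph ω).Reachable s x} *
            (prodBernoulli w).real {ω : BondConfig V | ∀ x ∈ insert z B, ¬ (openGraph ω).Reachable s x} -
          (prodBernoulli w).real {ω : BondConfig V | ∀ x ∈ B, ¬ (openGraph ω).Reachable s x} *
            (prodBernoulli w).real {ω : BondConfig V | ∀ x ∈ insert z C, ¬ (openGraph ω).Reachable s x})) :
    (prodBernoulli w).real ({ω : BondConfig V | ∀ x ∈ insert s C, ¬ (openGraph ω).Reachable y x} ∩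
        {ω | ∀ x ∈ C, ¬ (openGraph ω).Reachable s x} ∩ openConn y z) *
      ((prodBernoulli w).real {ω : BondConfig V | ∀ x ∈ A, ¬ (openGraph ω).Reachable s x} *
          (prodBernoulli w).real {ω : BondConfig V | ∀ x ∈ insert y B, ¬ (openGraph ω).Reachable s x} -
        (prodBernoulli w).real {ω : BondConfig V | ∀ x ∈ B, ¬ (openGraph ω).Reachable s x} *
          (prodBernoulli w).real {ω : BondConfig V | ∀ x ∈ insert y A, ¬ (openGraph ω).Reachable s x}) ≤
    (prodBernoulli w).real ({ω : BondConfig V | ∀ x ∈ insert s C, ¬ (openGraph ω).Reachable y x} ∩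
        {ω | ∀ x ∈ C, ¬ (openGraph ω).Reachable s x}) *
      ((prodBernoulli w).real {ω : BondConfig V | ∀ x ∈ A, ¬ (openGraph ω).Reachable s x} *
          (prodBernoulli w).real {ω : BondConfig V | ∀ x ∈ insert z B, ¬ (openGraph ω).Reachable s x} -
        (prodBernoulli w).real {ω : BondConfig V | ∀ x ∈ B, ¬ (openGraph ω).Reachable s x} *
          (prodBernoulli w).real {ω : BondConfig V | ∀ x ∈ insert z A, ¬ (openGraph ω).Reachable s x}) := by
  classical
  set μ := prodBernoulli w with hμ
  set tw := μ.real ({ω : BondConfig V | ∀ x ∈ insert s C, ¬ (openGraph ω).Reachable y x} ∩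
    {ω | ∀ x ∈ C, ¬ (openGraph ω).Reachable s x} ∩ openConn y z) with htw
  set t := μ.real ({ω : BondConfig V | ∀ x ∈ insert s C, ¬ (openGraph ω).Reachable y x} ∩
    {ω | ∀ x ∈ C, ¬ (openGraph ω).Reachable s x}) with ht
  set kA := μ.real {ω : BondConfig V | ∀ x ∈ A, ¬ (openGraph ω).Reachable s x} with hkA
  set kB := μ.real {ω : BondConfig V | ∀ x ∈ B, ¬ (openGraph ω).Reachable s x} with hkB
  set kC := μ.real {ω : BondConfig V | ∀ x ∈ C, ¬ (openGraph ω).Reachable s x} with hkC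
  set kAy := μ.real {ω : BondConfig V | ∀ x ∈ insert y A, ¬ (openGraph ω).Reachable s x} with hkAy
  set kBy := μ.real {ω : BondConfig V | ∀ x ∈ insert y B, ¬ (openGraph ω).Reachable s x} with hkBy
  set kCy := μ.real {ω : BondConfig V | ∀ x ∈ insert y C, ¬ (openGraph ω).Reachable s x} with hkCy
  set kAz := μ.real {ω : BondConfig V | ∀ x ∈ insert z A, ¬ (openGraph ω).Reachable s x} with hkAz
  set kBz := μ.real {ω : BondConfig V | ∀ x ∈ insert z B, ¬ (openGraph ω).Reachable s x} with hkBz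
  set kCz := μ.real {ω : BondConfig V | ∀ x ∈ insert z C, ¬ (openGraph ω).Reachable s x} with hkCz
  have h0 : ∀ S : Set (BondConfig V), 0 ≤ μ.real S := fun _ => measureReal_nonneg
  -- `K_C · (goal difference) = K_B · (h₁ difference) + K_A · (h₂ difference)`
  have key : kC * (t * (kA * kBz - kB * kAz) - tw * (kA * kBy - kB * kAy)) =
      kB * (t * (kA * kCz - kC * kAz) - tw * (kA * kCy - kC * kAy)) +
        kA * (t * (kC * kBz - kB * kCz) - tw * (kC * kBy - kB * kCy)) := by ring
  have hsum : 0 ≤ kC * (t * (kA * kBz - kB * kAz) - tw * (kA * kBy - kB * kAy)) := by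
    rw [key]
    exact add_nonneg (mul_nonneg (h0 _) (sub_nonneg.2 h₁)) (mul_nonneg (h0 _) (sub_nonneg.2 h₂))
  -- `T_C ⊆ R_C`, so `t ≤ K_C` and `tw ≤ t`
  have htC : t ≤ kC := measureReal_mono inter_subset_right
  have htwt : tw ≤ t := measureReal_mono inter_subset_left
  by_cases hC0 : kC = 0
  · have ht0 : t = 0 := le_antisymm (hC0 ▸ htC) (h0 _)
    have htw0 : tw = 0 := le_antisymm (ht0 ▸ htwt) (h0 _)
    rw [ht0, htw0]; simp
  · have hCpos : 0 < kC := lt_of_le_of_ne (h0 _) (Ne.symm hC0)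
    have : 0 ≤ t * (kA * kBz - kB * kAz) - tw * (kA * kBy - kB * kAy) := by
      by_contra hneg
      push Not at hneg
      have := mul_neg_of_pos_of_neg hCpos hneg
      linarith
    linarith

/-- **Proved corner `A = ∅`, `C = B` (the top edge from the empty set)**: the conjecture's inequality with `A = ∅`, `C = B` holds for every
graph — it is `Consts.uncondition_marker_le` (`K_∅ = 1`, `K_{B∪{t}} − K_B·K_{{t}} = μ(R_B)μ(s↔t) − μ(R_B ∩ {s↔t})`).
[cite: VandenbergHaggstromKahn2005, Thm. 1.3 (p. 6), Thm. 2.1 (p. 9) — corollary, derived here] -/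
theorem intervalLaw_top_empty (w : Sym2 V → unitInterval) (s y z : V) (B : Set V) :
    (prodBernoulli w).real ({ω : BondConfig V | ∀ x ∈ insert s B, ¬ (openGraph ω).Reachable y x} ∩
        {ω | ∀ x ∈ B, ¬ (openGraph ω).Reachable s x} ∩ openConn y z) *
      ((prodBernoulli w).real {ω : BondConfig V | ∀ x ∈ (∅ : Set V), ¬ (openGraph ω).Reachable s x} *
          (prodBernoulli w).real {ω : BondConfig V | ∀ x ∈ insert y B, ¬ (openGraph ω).Reachable s x} -
        (prodBernoulli w).real {ω : BondConfig V | ∀ x ∈ B, ¬ (openGraph ω).Reachable s x} *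
          (prodBernoulli w).real {ω : BondConfig V | ∀ x ∈ insert y (∅ : Set V), ¬ (openGraph ω).Reachable s x}) ≤
    (prodBernoulli w).real ({ω : BondConfig V | ∀ x ∈ insert s B, ¬ (openGraph ω).Reachable y x} ∩
        {ω | ∀ x ∈ B, ¬ (openGraph ω).Reachable s x}) *
      ((prodBernoulli w).real {ω : BondConfig V | ∀ x ∈ (∅ : Set V), ¬ (openGraph ω).Reachable s x} *
          (prodBernoulli w).real {ω : BondConfig V | ∀ x ∈ insert z B, ¬ (openGraph ω).Reachable s x} -
        (prodBernoulli w).real {ω : BondConfig V | ∀ x ∈ B, ¬ (openGraph ω).Reachable s x} *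
          (prodBernoulli w).real {ω : BondConfig V | ∀ x ∈ insert z (∅ : Set V), ¬ (openGraph ω).Reachable s x}) := by
  classical
  set μ := prodBernoulli w with hμ
  have key := uncondition_marker_le w s y z B
  have hU : {ω : BondConfig V | ∀ x ∈ (∅ : Set V), ¬ (openGraph ω).Reachable s x} = univ := by
    ext ω; simp
  have hsing : ∀ t : V, {ω : BondConfig V | ∀ x ∈ insert t (∅ : Set V), ¬ (openGraph ω).Reachable s x} = (openConn s t)ᶜ := by
    intro t; ext ω
    simp only [mem_setOf_eq, mem_insert_iff, mem_empty_iff_false, or_false, forall_eq, mem_compl_iff]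
    rfl
  have hins : ∀ t : V, μ.real {ω : BondConfig V | ∀ x ∈ insert t B, ¬ (openGraph ω).Reachable s x} =
      μ.real {ω : BondConfig V | ∀ x ∈ B, ¬ (openGraph ω).Reachable s x} -
        μ.real ({ω : BondConfig V | ∀ x ∈ B, ¬ (openGraph ω).Reachable s x} ∩ openConn s t) := by
    intro t
    have h := real_avoid_inter_conn_eq w s t B
    change μ.real ({ω : BondConfig V | ∀ x ∈ B, ¬ (openGraph ω).Reachable s x} ∩ openConn s t) = _ - _ at h
    linarith
  have hc : ∀ t : V, μ.real (openConn s t)ᶜ = 1 - μ.real (openConn s t) := fun t =>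
    probReal_compl_eq_one_sub (MeasurableSet.of_discrete)
  rw [hU, hsing, hsing, probReal_univ, hins y, hins z, hc y, hc z]
  have e1 : ∀ (d dy py : ℝ), 1 * (d - dy) - d * (1 - py) = d * py - dy := fun d dy py => by ring
  rw [e1, e1]
  exact key

/-- **Proved corner `C = A`, `B = A ∪ {y}`** (the bottom edge with the marker `y` as the added vertex): `Consts.MDLXJoint` at `F = 1{s↔y}`
(`Consts.mdlxJoint_at_connIndicator`) rewritten through `Consts.mdlxJoint_at_connIndicator_iff_minor`.
[cite: VandenbergHaggstromKahn2005, Thm. 1.3 (p. 6), Thm. 1.4 (p. 7) — corollary, derived here] -/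
theorem intervalLaw_bot_marker_y (w : Sym2 V → unitInterval) (s y z : V) (X : Set V) :
    (prodBernoulli w).real ({ω : BondConfig V | ∀ x ∈ insert s X, ¬ (openGraph ω).Reachable y x} ∩
        {ω | ∀ x ∈ X, ¬ (openGraph ω).Reachable s x} ∩ openConn y z) *
      ((prodBernoulli w).real {ω : BondConfig V | ∀ x ∈ X, ¬ (openGraph ω).Reachable s x} *
          (prodBernoulli w).real {ω : BondConfig V | ∀ x ∈ insert y (insert y X), ¬ (openGraph ω).Reachable s x} -
        (prodBernoulli w).real {ω : BondConfig V | ∀ x ∈ insert y X, ¬ (openGraph ω).Reachable s x} *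
          (prodBernoulli w).real {ω : BondConfig V | ∀ x ∈ insert y X, ¬ (openGraph ω).Reachable s x}) ≤
    (prodBernoulli w).real ({ω : BondConfig V | ∀ x ∈ insert s X, ¬ (openGraph ω).Reachable y x} ∩
        {ω | ∀ x ∈ X, ¬ (openGraph ω).Reachable s x}) *
      ((prodBernoulli w).real {ω : BondConfig V | ∀ x ∈ X, ¬ (openGraph ω).Reachable s x} *
          (prodBernoulli w).real {ω : BondConfig V | ∀ x ∈ insert z (insert y X), ¬ (openGraph ω).Reachable s x} -
        (prodBernoulli w).real {ω : BondConfig V | ∀ x ∈ insert y X, ¬ (openGraph ω).Reachable s x} *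
          (prodBernoulli w).real {ω : BondConfig V | ∀ x ∈ insert z X, ¬ (openGraph ω).Reachable s x}) := by
  have h := (mdlxJoint_at_connIndicator_iff_minor w s y y z X).1 (mdlxJoint_at_connIndicator w s y z X)
  rw [Set.insert_comm y z X] at h
  exact h

/-- **Proved corner `C = A`, `B = A ∪ {z}`** (the bottom edge with the marker `z` as the added vertex): `Consts.MDLXJoint` at `F = 1{s↔z}`
(`Consts.mdlxJoint_at_connIndicator_z`) rewritten through `Consts.mdlxJoint_at_connIndicator_iff_minor`.
[cite: VandenbergHaggstromKahn2005, Thm. 1.3 (p. 6), Thm. 1.4 (p. 7) — corollary, derived here] -/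
theorem intervalLaw_bot_marker_z (w : Sym2 V → unitInterval) (s y z : V) (X : Set V) :
    (prodBernoulli w).real ({ω : BondConfig V | ∀ x ∈ insert s X, ¬ (openGraph ω).Reachable y x} ∩
        {ω | ∀ x ∈ X, ¬ (openGraph ω).Reachable s x} ∩ openConn y z) *
      ((prodBernoulli w).real {ω : BondConfig V | ∀ x ∈ X, ¬ (openGraph ω).Reachable s x} *
          (prodBernoulli w).real {ω : BondConfig V | ∀ x ∈ insert y (insert z X), ¬ (openGraph ω).Reachable s x} -
        (prodBernoulli w).real {ω : BondConfig V | ∀ x ∈ insert z X, ¬ (openGraph ω).Reachable s x} *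
          (prodBernoulli w).real {ω : BondConfig V | ∀ x ∈ insert y X, ¬ (openGraph ω).Reachable s x}) ≤
    (prodBernoulli w).real ({ω : BondConfig V | ∀ x ∈ insert s X, ¬ (openGraph ω).Reachable y x} ∩
        {ω | ∀ x ∈ X, ¬ (openGraph ω).Reachable s x}) *
      ((prodBernoulli w).real {ω : BondConfig V | ∀ x ∈ X, ¬ (openGraph ω).Reachable s x} *
          (prodBernoulli w).real {ω : BondConfig V | ∀ x ∈ insert z (insert z X), ¬ (openGraph ω).Reachable s x} -
        (prodBernoulli w).real {ω : BondConfig V | ∀ x ∈ insert z X, ¬ (openGraph ω).Reachable s x} *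
          (prodBernoulli w).real {ω : BondConfig V | ∀ x ∈ insert z X, ¬ (openGraph ω).Reachable s x}) :=
by
  have h := (mdlxJoint_at_connIndicator_iff_minor w s z y z X).1 (mdlxJoint_at_connIndicator_z w s y z X)
  rw [Set.insert_comm z y X] at h
  exact h

end Consts

end Summit.CriticalPhenomena.PercolationContinuityZ3.Theorems

end
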